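import Summits.ABC.IUTFork.Joshi.ArithmeticoidsFactorMatching

/-!
# [J-2½] Thm. 5.5.2 (7) «topologically inequivalent arithmeticoids exist» DISCHARGED from print's ground
# `LocalTopInequivalent` by COUNTING PLACES OF A GIVEN RESIDUE-FIELD TYPE (arXiv:2305.10398 §5.2, §5.5)

Block E proof-only file (cell abc-iut, rung LADDER-ABC:A2.E; seat abc-iut-E-t37, author of `ATS2h.DeformationDatum` p430482, of the
claim-`Prop`s `DeformationDatum.TopEquivalent` / `LocalTopInequivalent` / `Thm552_7` p430871 and of the factorwise reading
`topEquivalent_iff_perm` p437051; own-claim discharge, ASSIGNMENTS §4 (1)). Same source and conventions: [J-2½] = K. Joshi,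
arXiv:2305.10398 (lit key `paper:arxiv-2305.10398`, bib `Joshi2023ATS2half`; «p.N l.M» = line M of
`HOME/plan/repair/lit/renders/Joshi-arxiv-2305.10398-ATS2half/pNNNN.txt`). TAKES NO SIDE on [IUTchIII] Cor. 3.12, on Joshi's claims, or
on Mochizuki's reports on them; typed ≠ proved for everything not derived here; nothing new is asserted (no `def`, no `Prop`).

WHAT IS DERIVED (over the abstract signature `DeformationDatum L V Lv Y K G A`; «type of a residue field» = its isomorphism class as a
TOPOLOGICAL FIELD, written inline as `∃ e : K ≃+* F, Continuous e ∧ Continuous e.symm` exactly as in p430871/p437051).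
1. PLACES OF A GIVEN TYPE ARE PERMUTED (`TopEquivalent.exists_perm_type`, from p437051 `TopEquivalent.exists_perm`): a topological
   equivalence `arith(L)_{y₁} ~ arith(L)_{y₂}` (Def. 5.2.1, p.31 l.44–45) carries a bijection `σ` of `V_L` mapping the places where
   `K_{y₁,v}` has type `F` into the places where `K_{y₂,w}` has type `F`, for every topological field `F`. PIGEONHOLE
   (`PlaceCount.false_of_mapsTo_ssubset`, `not_topEquivalent_of_typeSet_ssubset`): hence if the `F`-places of `y₂` form a FINITE PROPER
   SUBSET of the `F`-places of `y₁`, the two arithmeticoids are not topologically equivalent.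
2. **Thm. 5.5.2 (7) DISCHARGED** (`thm552_7_of_localTopInequivalent`): print's ground `LocalTopInequivalent` (p.35 l.23–30: «by [Kedlaya
   and Temkin, 2018], there exists, for any `v ∈ V^non_L`, a pair of closed classical points `y_{1,v}, y_{2,v}` such that the residue
   fields `K_{1,v}` and `K_{2,v}` are not topologically isomorphic») together with the two standing clauses of the number-field setting
   «`V^arc_L` is finite» and «`V^non_L ≠ ∅`» (hypotheses `D.Varc.Finite`, `∃ v, v ∉ D.Varc`; not fields of the signature) IMPLIES
   `Thm552_7` (p.34 l.28). The witnesses are NOT print's pair: fix `v₀ ∈ V^non` and `F := K_{v₀,y_a}` for a Kedlaya–Temkin pair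
   `(y_a, y_b)` at `v₀`; let `y₁` pick at every place a point of type `F` when one exists (TYPE-MAXIMISER) and `y₂` a point NOT of type
   `F` when one exists (TYPE-MINIMISER), `y⁰_v` otherwise. The `F`-places of `y₂` are the places where EVERY point has type `F`; by
   `LocalTopInequivalent` these are archimedean, hence finitely many, all of them `F`-places of `y₁`, and `v₀` is an `F`-place of `y₁`
   not of `y₂` — so 1. applies. (Without «`V^arc_L` finite» the argument, and plausibly the implication, fails in the abstract signature:
   infinitely many places where a type is forced leave room for Hilbert-hotel permutations; no model is built here.)
3. PRINT'S LITERAL PAIR, cross-place clause as FINITENESS (`not_topEquivalent_update_pt0`): `y⁰[v₀ ↦ y_a]` and `y⁰[v₀ ↦ y_b]`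
   (`y⁰ = D.pt0`, proof of (6) p.35 l.15–18) are not topologically equivalent as soon as only FINITELY many `K_{y⁰,w}` have the type of
   `K_{v₀,y_a}` — weaker than p437051's «unmatched» clause (which asks for NONE); in print `K_{y⁰,w} = L̂̄_w ≅ ℂ_{p_w}` and residue
   characteristics leave at most the finitely many `w ∣ p_{v₀}`.
4. LOCATED, for the faithfulness lane, kernel-level and with no verdict on print: the printed sentence (p.35 l.30–33) «choose a
   `v ∈ V^non_L` and `y₁, y₂ ∈ 𝒴_L` such that `y_{1,v} = y_{1,v}, y_{2,v} = y_{2,v}`. Then the arithmeticoids `y₁, y₂` are not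
   topologically [equivalent] by construction» does not hold for ALL `y₁, y₂` with the prescribed `v`-components: if the two types are
   also available at a second place `v₁ ≠ v` (in print: a second place of `L` over the same rational prime, same tilt `ℂ^♭_p`), the points
   `y⁰[v₁ ↦ z_b][v ↦ y_a]`, `y⁰[v₁ ↦ z_a][v ↦ y_b]` have the prescribed `v`-components and ARE topologically equivalent, by the
   transposition `(v v₁)` (`topEquivalent_of_swap`, `exists_topEquivalent_prescribed`). Statement (7) itself is unaffected (2.).
-/

noncomputable section

open TopologicalSpace

namespace Summit.ABC.IUTFork.Joshi.ATS2h

/-! ## 0. Bookkeeping: isomorphisms of topological rings/fields, in the inline form of p430871 -/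

namespace TopFieldIso

variable {A B C : Type} [Mul A] [Add A] [TopologicalSpace A] [Mul B] [Add B] [TopologicalSpace B]
  [Mul C] [Add C] [TopologicalSpace C]

/-- Reflexivity: the identity is an isomorphism of topological rings. [folklore] -/
theorem refl : ∃ e : A ≃+* A, Continuous e ∧ Continuous e.symm :=
  ⟨RingEquiv.refl A, continuous_id, continuous_id⟩

/-- Symmetry: the inverse of an isomorphism of topological rings is one. [folklore] -/
theorem symm (h : ∃ e : A ≃+* B, Continuous e ∧ Continuous e.symm) :
    ∃ e : B ≃+* A, Continuous e ∧ Continuous e.symm := by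
  obtain ⟨e, he, he'⟩ := h
  exact ⟨e.symm, he', by simpa using he⟩

/-- Transitivity: isomorphisms of topological rings compose. [folklore] -/
theorem trans (h : ∃ e : A ≃+* B, Continuous e ∧ Continuous e.symm)
    (h' : ∃ e : B ≃+* C, Continuous e ∧ Continuous e.symm) :
    ∃ e : A ≃+* C, Continuous e ∧ Continuous e.symm := by
  obtain ⟨e, he, he'⟩ := h
  obtain ⟨f, hf, hf'⟩ := h'
  exact ⟨e.trans f, hf.comp he, he'.comp hf'⟩

/-- Transport along an equality of indices in a family of topological rings (used for the components of updated points
`y⁰[v ↦ y_v]` of `𝒴_L`). [folklore] -/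
theorem of_eq {I : Type} (R : I → Type) [∀ i, Mul (R i)] [∀ i, Add (R i)] [∀ i, TopologicalSpace (R i)] {i i' : I}
    (h : i = i') : ∃ e : R i ≃+* R i', Continuous e ∧ Continuous e.symm := by
  subst h
  exact refl

end TopFieldIso

/-! ## 1. Pigeonhole on places -/

namespace PlaceCount

/-- PIGEONHOLE: a bijection `σ` of the places cannot map a set `T₁` into a finite proper subset `T₂ ⊂ T₁` (it would inject `T₁`
into `T₂`, forcing `T₁` finite of cardinality at most that of `T₂`). [folklore] -/
theorem false_of_mapsTo_ssubset {V : Type} (σ : V ≃ V) {T₁ T₂ : Set V} (hmap : Set.MapsTo σ T₁ T₂) (hss : T₂ ⊂ T₁)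
    (hfin : T₂.Finite) : False := by
  have himg : σ '' T₁ ⊆ T₂ := hmap.image_subset
  have hfin₁ : T₁.Finite := Set.Finite.of_finite_image (hfin.subset himg) σ.injective.injOn
  have h1 : (σ '' T₁).ncard ≤ T₂.ncard := Set.ncard_le_ncard himg hfin
  rw [Set.ncard_image_of_injective T₁ σ.injective] at h1
  exact (h1.trans_lt (Set.ncard_lt_ncard hss hfin₁)).false

end PlaceCount

namespace DeformationDatum

variable {L : Type} [Field L] {V : Type} {Lv : V → Type} [∀ v, Field (Lv v)] {Y : V → Type}
  [∀ v, TopologicalSpace (Y v)] {K : (v : V) → Y v → Type} [∀ v y, Field (K v y)] [∀ v y, TopologicalSpace (K v y)]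
  {G : V → Type} [∀ v, Group (G v)] {A : V → Type} [∀ v, Group (A v)]
  (D : DeformationDatum L V Lv Y K G A)

/-! ## 2. Def. 5.2.1 permutes the places of a given residue-field type -/

/-- **Places of a given residue-field type are permuted** ([J-2½] Def. 5.2.1, p.31 l.44–45, read through p437051
`TopEquivalent.exists_perm`): a topological equivalence `arith(L)_{y₁} ~ arith(L)_{y₂}` provides a bijection `σ : V_L ≃ V_L` such
that whenever `K_{y₁,v}` is isomorphic as a topological field to a given topological field `F`, so is `K_{y₂,σ(v)}`. [claim:
Joshi2023ATS2half, status: disputed] -/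
theorem TopEquivalent.exists_perm_type {F : Type} [Field F] [TopologicalSpace F] {y₁ y₂ : D.Arith}
    (h : D.TopEquivalent y₁ y₂) :
    ∃ σ : V ≃ V, ∀ v, (∃ e : K v (y₁ v) ≃+* F, Continuous e ∧ Continuous e.symm) →
      ∃ e : K (σ v) (y₂ (σ v)) ≃+* F, Continuous e ∧ Continuous e.symm := by
  obtain ⟨σ, hσ⟩ := TopEquivalent.exists_perm D h
  exact ⟨σ, fun v hv => TopFieldIso.trans (TopFieldIso.symm (hσ v)) hv⟩

/-- **Pigeonhole form of Def. 5.2.1**: if, for some topological field `F`, the set of places `w` at which `K_{y₂,w}` has the type of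
`F` is FINITE and a PROPER SUBSET of the set of places at which `K_{y₁,v}` has the type of `F`, then `arith(L)_{y₁}` and
`arith(L)_{y₂}` are not topologically equivalent. [claim: Joshi2023ATS2half, status: disputed] -/
theorem not_topEquivalent_of_typeSet_ssubset {F : Type} [Field F] [TopologicalSpace F] {y₁ y₂ : D.Arith}
    (hss : {w | ∃ e : K w (y₂ w) ≃+* F, Continuous e ∧ Continuous e.symm} ⊂
      {v | ∃ e : K v (y₁ v) ≃+* F, Continuous e ∧ Continuous e.symm})
    (hfin : {w | ∃ e : K w (y₂ w) ≃+* F, Continuous e ∧ Continuous e.symm}.Finite) :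
    ¬ D.TopEquivalent y₁ y₂ := fun hT => by
  obtain ⟨σ, hσ⟩ := TopEquivalent.exists_perm_type D (F := F) hT
  exact PlaceCount.false_of_mapsTo_ssubset σ (fun v hv => hσ v hv) hss hfin

/-! ## 3. Thm. 5.5.2 (7) from `LocalTopInequivalent` -/

/-- **[J-2½] Thm. 5.5.2 (7) DISCHARGED from print's ground** (statement p.34 l.28 «topologically inequivalent arithmeticoids of `L`
also exist»; ground p.35 l.23–30 = `LocalTopInequivalent`, [Kedlaya–Temkin 2018] at every `v ∈ V^non_L`), under the standing clauses
of the number-field setting «`V^arc_L` finite» and «`V^non_L ≠ ∅`». WITNESSES (not print's pair; see `not_topEquivalent_update_pt0`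
for that one): with `v₀ ∈ V^non_L`, `(y_a, y_b)` a Kedlaya–Temkin pair at `v₀` and `F := K_{v₀,y_a}`, the TYPE-MAXIMISER `y₁` (a point
of type `F` wherever one exists, else `y⁰_v`) and the TYPE-MINIMISER `y₂` (a point not of type `F` wherever one exists, else `y⁰_v`):
the `F`-places of `y₂` are places where every point has type `F`, hence archimedean (at a non-archimedean place the Kedlaya–Temkin
pair cannot both have type `F`), hence finitely many, each an `F`-place of `y₁`, while `v₀` is an `F`-place of `y₁` and not of
`y₂`; conclude by `not_topEquivalent_of_typeSet_ssubset`. [claim: Joshi2023ATS2half, status: disputed] -/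
theorem thm552_7_of_localTopInequivalent (hfin : D.Varc.Finite) (hne : ∃ v, v ∉ D.Varc)
    (h : D.LocalTopInequivalent) : D.Thm552_7 := by
  classical
  obtain ⟨v₀, hv₀⟩ := hne
  obtain ⟨ya, yb, hab⟩ := h v₀ hv₀
  -- `P v y`: the residue field `K_{v,y}` has the type of `F := K_{v₀,y_a}`
  let P : (v : V) → Y v → Prop := fun v y => ∃ e : K v y ≃+* K v₀ ya, Continuous e ∧ Continuous e.symm
  -- the type-maximiser and the type-minimiser
  let y₁ : D.Arith := fun v => if hv : ∃ y, P v y then hv.choose else D.pt0 v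
  let y₂ : D.Arith := fun v => if hv : ∃ y, ¬ P v y then hv.choose else D.pt0 v
  have h1 : ∀ v, (∃ y, P v y) → P v (y₁ v) := fun v hv => by
    have e : y₁ v = hv.choose := dif_pos hv
    rw [e]
    exact hv.choose_spec
  have h2 : ∀ v, (∃ y, ¬ P v y) → ¬ P v (y₂ v) := fun v hv => by
    have e : y₂ v = hv.choose := dif_pos hv
    rw [e]
    exact hv.choose_spec
  -- at a non-archimedean place not every point has type `F`
  have h3 : ∀ w, w ∉ D.Varc → ∃ y, ¬ P w y := fun w hw => by
    obtain ⟨z₁, z₂, hz⟩ := h w hw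
    by_contra hall
    push Not at hall
    exact hz (TopFieldIso.trans (hall z₁) (TopFieldIso.symm (hall z₂)))
  -- an `F`-place of `y₂` is a place where every point has type `F`
  have h4 : ∀ w, P w (y₂ w) → ∀ y, P w y := fun w hw => by
    by_contra hex
    push Not at hex
    exact h2 w hex hw
  refine ⟨y₁, y₂, not_topEquivalent_of_typeSet_ssubset D (F := K v₀ ya) ?_ ?_⟩
  · refine Set.ssubset_iff_subset_ne.mpr ⟨fun w hw => h1 w ⟨y₂ w, hw⟩, fun hEq => ?_⟩
    have hv₀T : v₀ ∈ {v | P v (y₁ v)} := h1 v₀ ⟨ya, TopFieldIso.refl⟩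
    rw [← hEq] at hv₀T
    exact h2 v₀ (h3 v₀ hv₀) hv₀T
  · refine hfin.subset fun w hw => ?_
    by_contra hwarc
    obtain ⟨y, hy⟩ := h3 w hwarc
    exact hy (h4 w hw y)

/-! ## 4. Print's literal pair `y⁰[v₀ ↦ y_a]`, `y⁰[v₀ ↦ y_b]`: the cross-place clause as finiteness -/

/-- **Print's pair, cross-place clause as FINITENESS** (proof of Thm. 5.5.2 (7), p.35 l.23–33, with `y⁰` of the proof of (6),
p.35 l.15–18): if `K_{v₀,y_a}` and `K_{v₀,y_b}` are not isomorphic as topological fields and only FINITELY many residue fields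
`K_{y⁰,w}` of the base point have the type of `K_{v₀,y_a}`, then `y⁰[v₀ ↦ y_a]` and `y⁰[v₀ ↦ y_b]` are not topologically equivalent:
the `K_{v₀,y_a}`-places of the second point lie among those finitely many `w`, all `≠ v₀` and all `K_{v₀,y_a}`-places of the first
point, which moreover has `v₀`. Weaker than p437051 `thm552_7_of_unmatched` (no `K_{y⁰,w}` of that type at all); in print
`K_{y⁰,w} = L̂̄_w`, and only the finitely many `w ∣ p_{v₀}` can qualify. [claim: Joshi2023ATS2half, status: disputed] -/
theorem not_topEquivalent_update_pt0 [DecidableEq V] {v₀ : V} (ya yb : Y v₀)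
    (hab : ¬ ∃ e : K v₀ ya ≃+* K v₀ yb, Continuous e ∧ Continuous e.symm)
    (hfinT : {w | ∃ e : K w (D.pt0 w) ≃+* K v₀ ya, Continuous e ∧ Continuous e.symm}.Finite) :
    ¬ D.TopEquivalent (Function.update D.pt0 v₀ ya) (Function.update D.pt0 v₀ yb) := by
  -- an `F`-place `w` of `y⁰[v₀ ↦ y_b]` is `≠ v₀` and an `F`-place of `y⁰`
  have hT₂ : ∀ w, (∃ e : K w (Function.update D.pt0 v₀ yb w) ≃+* K v₀ ya, Continuous e ∧ Continuous e.symm) →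
      w ≠ v₀ ∧ ∃ e : K w (D.pt0 w) ≃+* K v₀ ya, Continuous e ∧ Continuous e.symm := by
    intro w hw
    by_cases hwv : w = v₀
    · subst hwv
      exact absurd (TopFieldIso.symm
        (TopFieldIso.trans (TopFieldIso.of_eq (K w) (Function.update_self w yb D.pt0).symm) hw)) hab
    · exact ⟨hwv, TopFieldIso.trans (TopFieldIso.of_eq (K w) (Function.update_of_ne hwv yb D.pt0).symm) hw⟩
  refine not_topEquivalent_of_typeSet_ssubset D (F := K v₀ ya) ?_ ?_
  · refine Set.ssubset_iff_subset_ne.mpr ⟨fun w hw => ?_, fun hEq => ?_⟩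
    · obtain ⟨hwv, hw'⟩ := hT₂ w hw
      exact TopFieldIso.trans (TopFieldIso.of_eq (K w) (Function.update_of_ne hwv ya D.pt0)) hw'
    · have hv₀T : v₀ ∈ {v | ∃ e : K v (Function.update D.pt0 v₀ ya v) ≃+* K v₀ ya, Continuous e ∧ Continuous e.symm} :=
        TopFieldIso.of_eq (K v₀) (Function.update_self v₀ ya D.pt0)
      rw [← hEq] at hv₀T
      exact (hT₂ v₀ hv₀T).1 rfl
  · exact hfinT.subset fun w hw => (hT₂ w hw).2

/-- Hence Thm. 5.5.2 (7) from print's literal construction, the cross-place clause being FINITENESS of the set of places `w`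
with `K_{y⁰,w}` of the type of the Kedlaya–Temkin field `K_{v₀,y_a}`. [claim: Joshi2023ATS2half, status: disputed] -/
theorem thm552_7_of_localTopInequivalent_of_finite_type [DecidableEq V] {v₀ : V} (ya yb : Y v₀)
    (hab : ¬ ∃ e : K v₀ ya ≃+* K v₀ yb, Continuous e ∧ Continuous e.symm)
    (hfinT : {w | ∃ e : K w (D.pt0 w) ≃+* K v₀ ya, Continuous e ∧ Continuous e.symm}.Finite) : D.Thm552_7 :=
  ⟨_, _, not_topEquivalent_update_pt0 D ya yb hab hfinT⟩

/-! ## 5. LOCATED: prescribing the `v`-components alone does not decide (in)equivalence -/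

/-- **Swap witness**: if the residue fields of `y₁` at `v₀`, `v₁` have the types of those of `y₂` at `v₁`, `v₀` respectively, and
the same types elsewhere place by place, then `arith(L)_{y₁} ~ arith(L)_{y₂}` (Def. 5.2.1) — by p437051 `topEquivalent_of_perm`
along the transposition `(v₀ v₁)`. [claim: Joshi2023ATS2half, status: disputed] -/
theorem topEquivalent_of_swap [DecidableEq V] {y₁ y₂ : D.Arith} (v₀ v₁ : V)
    (h₀ : ∃ e : K v₀ (y₁ v₀) ≃+* K v₁ (y₂ v₁), Continuous e ∧ Continuous e.symm)
    (h₁ : ∃ e : K v₁ (y₁ v₁) ≃+* K v₀ (y₂ v₀), Continuous e ∧ Continuous e.symm)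
    (h : ∀ v, v ≠ v₀ → v ≠ v₁ → ∃ e : K v (y₁ v) ≃+* K v (y₂ v), Continuous e ∧ Continuous e.symm) :
    D.TopEquivalent y₁ y₂ := by
  refine topEquivalent_of_perm D (Equiv.swap v₀ v₁) fun v => ?_
  by_cases hv0 : v = v₀
  · subst hv0
    rw [Equiv.swap_apply_left]
    exact h₀
  · by_cases hv1 : v = v₁
    · subst hv1
      rw [Equiv.swap_apply_right]
      exact h₁
    · rw [Equiv.swap_apply_of_ne_of_ne hv0 hv1]
      exact h v hv0 hv1

/-- **LOCATED (p.35 l.30–33 «choose `v ∈ V^non_L` and `y₁, y₂ ∈ 𝒴_L` with `y_{1,v} = y_{1,v}`, `y_{2,v} = y_{2,v}`; then … not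
topologically [equivalent] by construction»)**: prescribing the `v₀`-components does NOT by itself force inequivalence. If the types
of `K_{v₀,y_a}` and `K_{v₀,y_b}` are also realised at a second place `v₁ ≠ v₀` (by points `z_a`, `z_b`), then the points
`y⁰[v₁ ↦ z_b][v₀ ↦ y_a]` and `y⁰[v₁ ↦ z_a][v₀ ↦ y_b]` have the prescribed `v₀`-components `y_a`, `y_b` and ARE topologically
equivalent (`topEquivalent_of_swap`). No verdict on print: statement (7) holds regardless (`thm552_7_of_localTopInequivalent`).
[claim: Joshi2023ATS2half, status: disputed] -/
theorem exists_topEquivalent_prescribed [DecidableEq V] {v₀ v₁ : V} (hne : v₁ ≠ v₀) (ya yb : Y v₀) (za zb : Y v₁)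
    (ha : ∃ e : K v₀ ya ≃+* K v₁ za, Continuous e ∧ Continuous e.symm)
    (hb : ∃ e : K v₁ zb ≃+* K v₀ yb, Continuous e ∧ Continuous e.symm) :
    ∃ y₁ y₂ : D.Arith, y₁ v₀ = ya ∧ y₂ v₀ = yb ∧ D.TopEquivalent y₁ y₂ := by
  refine ⟨Function.update (Function.update D.pt0 v₁ zb) v₀ ya, Function.update (Function.update D.pt0 v₁ za) v₀ yb,
    Function.update_self v₀ ya _, Function.update_self v₀ yb _, topEquivalent_of_swap D v₀ v₁ ?_ ?_ ?_⟩
  · refine TopFieldIso.trans (TopFieldIso.of_eq (K v₀) (Function.update_self v₀ ya _))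
      (TopFieldIso.trans ha (TopFieldIso.of_eq (K v₁) ?_))
    rw [Function.update_of_ne hne, Function.update_self]
  · refine TopFieldIso.trans (TopFieldIso.of_eq (K v₁) ?_)
      (TopFieldIso.trans hb (TopFieldIso.of_eq (K v₀) (Function.update_self v₀ yb _).symm))
    rw [Function.update_of_ne hne, Function.update_self]
  · intro v hv0 hv1
    refine TopFieldIso.of_eq (K v) ?_
    rw [Function.update_of_ne hv0, Function.update_of_ne hv1, Function.update_of_ne hv0, Function.update_of_ne hv1]

end DeformationDatum

end Summit.ABC.IUTFork.Joshi.ATS2h
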